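import Literature.AnabelianGeometry.AbsoluteAnabelian.ProfiniteElasticOpenSubgroups
import Literature.AnabelianGeometry.AbsoluteAnabelian.SlimFiniteNormalProofs
import HarnessLib

/-!
# Elasticity ASCENDS from an open subgroup of a slim profinite group ([AbsTopI] Def 1.1 (ii), §0)

S. Mochizuki, *Topics in Absolute Anabelian Geometry I: Generalities* (2012) [AbsTopI] (lit key
`paper:url-11ac98ba15fc`), Def 1.1 (ii) p. 10 ("`G` is elastic if every topologically finitely generated
closed normal subgroup `N ⊆ H` of an open subgroup `H ⊆ G` of `G` is either trivial or of finite index in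
`G`") and §0 p. 8 ("every finite normal closed subgroup `N ⊆ G` of a slim profinite group `G` is trivial").

The tree has the DESCENT `IsElastic.subgroup_of_isOpen` (elastic `G` ⇒ open subgroups elastic,
`ProfiniteElasticOpenSubgroups.lean`).  This PROOF-ONLY file (no definition, no named fact) proves the
ASCENT under slimness:

* `isElastic_of_isSlimGroup_of_isOpen_of_isElastic` — **if `G` is a slim compact Hausdorff topological group
  and some OPEN subgroup `U ⊆ G` is elastic, then `G` is elastic.**  Proof: for `N ⊴ H` (`H ⊆ G` open, `N`
  closed, topologically finitely generated) apply the elasticity of `U` to `N ∩ U ⊴ H ∩ U` (open in `U`;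
  `N ∩ U` is open in the compact t.f.g. group `N`, hence t.f.g., `IsTopologicallyFinitelyGenerated.subgroup_isOpen`):
  either `[U : N ∩ U] < ∞`, whence `[G : N] < ∞`; or `N ∩ U = 1`, whence `N ↪ G/U` is FINITE, so `N` is a
  finite normal subgroup of the slim group `H` (open subgroups of slim groups are slim) and is trivial by
  §0 (`eq_bot_of_finite_normal_of_isSlimGroup`, `SlimFiniteNormalProofs.lean`).
* `isElastic_iff_of_isSlimGroup_of_isOpen` — for slim compact Hausdorff `G` and `U ⊆ G` open:
  `IsElastic G ↔ IsElastic U`.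

USE (node AbsTopI:Prop2.3(i), [AbsTopI] Prop 2.3 (i) "`Δ` is slim and elastic" for `Δ` of GFG-type): Def.
2.1 (i)'s GFG-type groups are ALMOST pro-`Σ` — `Δ_X` is an extension of the finite group `Gal(Y/X)` by the
pro-`Σ` fundamental group of the covering `Y`, which is OPEN in `Δ_X`; so, GIVEN slimness of `Δ_X`, its
elasticity reduces by this file to the elasticity of the open pro-`Σ` surface-group subgroup, proved in the
tree at the surface-group model (`geomSlimElastic_of_isProSigmaCompletion_closedSurfaceGroup`, abc-iut-L4-d1;
`slim_and_elastic_of_isProSigmaCompletion_puncturedSurfaceGroup`, abc-iut-w5-d206).  Classical; OUR kernel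
check; nothing here bears on [IUTchIII] Cor. 3.12.
-/

noncomputable section

open Topology

universe u

namespace Literature.AnabelianGeometry.AbsoluteAnabelian

open Literature.AlgebraicGeometry.Frobenioids (IsSlimGroup)

variable {G : Type u} [Group G] [TopologicalSpace G] [IsTopologicalGroup G]

omit [IsTopologicalGroup G] in
/-- Open subgroups of slim groups are slim (an open subgroup of the open `H` is open in `G`, so its
centraliser in `G`, a fortiori in `H`, is trivial).  (Same statement as the tree's
`Literature.AnabelianGeometry.SemiGraphs.isSlimGroup_subgroup_of_isOpen`, re-derived here to keep this generic
file free of the tempered-groups import chain.) [cite: MochizukiAbsTopI2012, §0 p.8] -/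
private theorem isSlimGroup_subgroup_of_isOpen_aux (hG : IsSlimGroup G) (H : Subgroup G)
    (hH : IsOpen (H : Set G)) : IsSlimGroup H := by
  refine ⟨fun V hV => ?_⟩
  have hVo : IsOpen ((V.map H.subtype : Subgroup G) : Set G) := by
    have : ((V.map H.subtype : Subgroup G) : Set G) = Subtype.val '' (V : Set H) := by
      ext x; simp
    rw [this]
    exact hH.isOpenMap_subtype_val _ hV
  have hc := hG.centralizer_eq_bot _ hVo
  refine (Subgroup.eq_bot_iff_forall _).mpr fun c hc' => ?_
  have hcG : (c : G) ∈ Subgroup.centralizer ((V.map H.subtype : Subgroup G) : Set G) := by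
    rw [Subgroup.mem_centralizer_iff]
    rintro _ ⟨v, hv, rfl⟩
    exact congrArg Subtype.val (Subgroup.mem_centralizer_iff.mp hc' v hv)
  rw [hc] at hcG
  exact Subtype.ext (Subgroup.mem_bot.mp hcG)

/-- A subgroup meeting an open subgroup of a compact group trivially is finite (it injects into the
finite coset space `G/U`). [cite: MochizukiAbsTopI2012, §0 p.8] -/
theorem finite_of_inf_eq_bot_of_isOpen [CompactSpace G] (N U : Subgroup G) (hUo : IsOpen (U : Set G))
    (h : N ⊓ U = ⊥) : (N : Set G).Finite := by
  haveI : Finite (G ⧸ U) := Subgroup.quotient_finite_of_isOpen U hUo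
  have hinj : Function.Injective fun n : N => ((n : G) : G ⧸ U) := by
    intro a b hab
    have hmem : (a : G)⁻¹ * b ∈ U := QuotientGroup.eq.mp hab
    have hN : (a : G)⁻¹ * b ∈ N := N.mul_mem (N.inv_mem a.2) b.2
    have h1 : (a : G)⁻¹ * b ∈ N ⊓ U := ⟨hN, hmem⟩
    rw [h, Subgroup.mem_bot] at h1
    exact Subtype.ext (inv_mul_eq_one.mp h1)
  haveI : Finite N := Finite.of_injective _ hinj
  exact Set.toFinite _

/-- **Elasticity ascends from an open subgroup of a slim compact Hausdorff group**: if `G` is slim and an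
open subgroup `U ⊆ G` is elastic, then `G` is elastic ([AbsTopI] Def 1.1 (ii); the case `N ∩ U = 1` is
killed by §0 "a slim group has no nontrivial finite normal subgroups" applied inside the slim open
subgroup `H`). [cite: MochizukiAbsTopI2012, Def 1.1 (ii) p.10] -/
theorem isElastic_of_isSlimGroup_of_isOpen_of_isElastic [CompactSpace G] [T2Space G]
    (hG : IsSlimGroup G) (U : Subgroup G) (hUo : IsOpen (U : Set G)) (hU : IsElastic U) :
    IsElastic G := by
  classical
  refine ⟨fun H N hHo hNH hNn hNc hNfg => ?_⟩
  -- pull `H`, `N` back to `U`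
  let HU : Subgroup U := H.subgroupOf U
  let NU : Subgroup U := N.subgroupOf U
  have hHUo : IsOpen (HU : Set U) := by
    rw [Subgroup.coe_subgroupOf]
    exact hHo.preimage continuous_subtype_val
  have hNUle : NU ≤ HU := fun x hx => by
    rw [Subgroup.mem_subgroupOf] at hx ⊢
    exact hNH hx
  have hNUc : IsClosed (NU : Set U) := by
    rw [Subgroup.coe_subgroupOf]
    exact hNc.preimage continuous_subtype_val
  have hNUn : (NU.subgroupOf HU).Normal := by
    refine ⟨fun n hn g => ?_⟩
    rw [Subgroup.mem_subgroupOf, Subgroup.mem_subgroupOf] at hn ⊢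
    have hgH : ((g : U) : G) ∈ H := by
      have := g.2
      rw [Subgroup.mem_subgroupOf] at this
      exact this
    have hnN : (((n : HU) : U) : G) ∈ N := hn
    have hnH : (((n : HU) : U) : G) ∈ H := hNH hnN
    have h1 := hNn.conj_mem ⟨(((n : HU) : U) : G), hnH⟩
      (by rw [Subgroup.mem_subgroupOf]; exact hnN) ⟨((g : U) : G), hgH⟩
    rw [Subgroup.mem_subgroupOf] at h1
    exact h1
  -- `N ∩ U` is topologically finitely generated: it is open in the compact t.f.g. group `N`
  have hNUfg : IsTopologicallyFinitelyGenerated NU := by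
    haveI : CompactSpace N := isCompact_iff_compactSpace.mp hNc.isCompact
    have hWo : IsOpen ((U.subgroupOf N : Subgroup N) : Set N) := by
      rw [Subgroup.coe_subgroupOf]
      exact hUo.preimage continuous_subtype_val
    have hW : IsTopologicallyFinitelyGenerated (U.subgroupOf N) := hNfg.subgroup_isOpen _ hWo
    have hmemU : ∀ x : U.subgroupOf N, ((x : N) : G) ∈ U := fun x => by
      have hx := x.2
      rw [Subgroup.mem_subgroupOf] at hx
      exact hx
    have hmemN : ∀ x : U.subgroupOf N, (⟨((x : N) : G), hmemU x⟩ : U) ∈ NU := fun x => by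
      change _ ∈ N.subgroupOf U
      rw [Subgroup.mem_subgroupOf]
      exact (x : N).2
    let f : (U.subgroupOf N) →ₜ* NU :=
      { toFun := fun x => ⟨⟨((x : N) : G), hmemU x⟩, hmemN x⟩
        map_one' := Subtype.ext (Subtype.ext rfl)
        map_mul' := fun _ _ => Subtype.ext (Subtype.ext rfl)
        continuous_toFun := by
          apply Continuous.subtype_mk
          apply Continuous.subtype_mk
          exact continuous_subtype_val.comp continuous_subtype_val }
    have hf : Function.Surjective f := by
      rintro ⟨⟨x, hxU⟩, hxN⟩
      rw [Subgroup.mem_subgroupOf] at hxN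
      exact ⟨⟨⟨x, hxN⟩, by rw [Subgroup.mem_subgroupOf]; exact hxU⟩, rfl⟩
    exact IsTopologicallyFinitelyGenerated.of_surjective f hf hW
  -- elasticity of `U`
  rcases hU.eq_bot_or_finiteIndex HU NU hHUo hNUle hNUn hNUc hNUfg with h | h
  · -- `N ∩ U = 1`: `N` is finite, normal in the slim open subgroup `H`, hence trivial
    left
    have hinf : N ⊓ U = ⊥ := by
      rw [eq_bot_iff]
      rintro x ⟨hxN, hxU⟩
      have hx : (⟨x, hxU⟩ : U) ∈ NU := by rw [Subgroup.mem_subgroupOf]; exact hxN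
      rw [h, Subgroup.mem_bot] at hx
      exact Subgroup.mem_bot.mpr (congrArg Subtype.val hx)
    have hfin : (N : Set G).Finite := finite_of_inf_eq_bot_of_isOpen N U hUo hinf
    have hHslim : IsSlimGroup H := isSlimGroup_subgroup_of_isOpen_aux hG H hHo
    haveI : (N.subgroupOf H).Normal := hNn
    have hfinH : ((N.subgroupOf H : Subgroup H) : Set H).Finite := by
      rw [Subgroup.coe_subgroupOf]
      exact hfin.preimage Subtype.val_injective.injOn
    have hbot := eq_bot_of_finite_normal_of_isSlimGroup hHslim (N.subgroupOf H) hfinH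
    rw [eq_bot_iff]
    intro n hn
    have : (⟨n, hNH hn⟩ : H) ∈ N.subgroupOf H := by rw [Subgroup.mem_subgroupOf]; exact hn
    rw [hbot, Subgroup.mem_bot] at this
    exact Subgroup.mem_bot.mpr (congrArg Subtype.val this)
  · -- `[U : N ∩ U] < ∞` and `[G : U] < ∞` give `[G : N] < ∞`
    right
    haveI : Finite (G ⧸ U) := Subgroup.quotient_finite_of_isOpen U hUo
    haveI : U.FiniteIndex := Subgroup.finiteIndex_of_finite_quotient
    haveI : NU.FiniteIndex := h
    haveI : (N ⊓ U).FiniteIndex := by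
      rw [← Subgroup.subgroupOf_map_subtype N U]
      refine ⟨fun h0 => ?_⟩
      rw [Subgroup.index_map_subtype] at h0
      rcases mul_eq_zero.mp h0 with h1 | h1
      · exact h.index_ne_zero h1
      · exact Subgroup.FiniteIndex.index_ne_zero h1
    exact Subgroup.finiteIndex_of_le (inf_le_left : N ⊓ U ≤ N)

/-- For a slim compact Hausdorff group and an open subgroup `U`: `G` is elastic iff `U` is (descent =
`IsElastic.subgroup_of_isOpen`, ascent = slimness + §0). [cite: MochizukiAbsTopI2012, Def 1.1 (ii) p.10] -/
theorem isElastic_iff_of_isSlimGroup_of_isOpen [CompactSpace G] [T2Space G] (hG : IsSlimGroup G)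
    (U : Subgroup G) (hUo : IsOpen (U : Set G)) : IsElastic G ↔ IsElastic U :=
  ⟨fun h => h.subgroup_of_isOpen U hUo, isElastic_of_isSlimGroup_of_isOpen_of_isElastic hG U hUo⟩

namespace FundamentalExtension

/-- Packaged for the typed node predicate: if `Δ = E.geom` is slim and has an elastic OPEN subgroup (e.g. the
pro-`Σ` fundamental group of a finite étale covering `Y → X` inside an almost pro-`Σ` GFG-type group), then
`E.GeomSlimElastic` holds. [cite: MochizukiAbsTopI2012, Prop 2.3 (i) p.19] -/
theorem geomSlimElastic_of_slim_of_isOpen_isElastic (E : FundamentalExtension.{u}) (hΔ : IsSlimGroup E.geom)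
    (U : Subgroup E.geom) (hUo : IsOpen (U : Set E.geom)) (hU : IsElastic U) : E.GeomSlimElastic := by
  haveI : CompactSpace E.geom := isCompact_iff_compactSpace.mp E.isClosed_geom.isCompact
  exact ⟨hΔ, isElastic_of_isSlimGroup_of_isOpen_of_isElastic hΔ U hUo hU⟩

end FundamentalExtension

end Literature.AnabelianGeometry.AbsoluteAnabelian

end
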